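import Summits.HodgeConjecture.HodgeConjecture.Theses.CurveNetMordellWeil
import Literature.AlgebraicGeometry.HodgeTheory.SupportedHodgeClassesAlgebraic
import Literature.AlgebraicGeometry.Resolution.ProjectiveResolutionProofs
import HarnessLib

/-!
# Route CurveNetMordellWeil · `DeligneDescent` (stmt-HodgeConjecture-2786) from the Literature named facts

The support item `DeligneDescent` of the route
`Summits/HodgeConjecture/HodgeConjecture/Theses/CurveNetMordellWeil` (Deligne, *Hodge III*,
Cor. 8.2.8 + semisimplicity of polarisable Hodge structures + Hironaka): for `X` smooth projective of
dimension `n` over `ℂ`, `Y ⊊ X` Zariski-closed and a rational `(q,q)`-class `c ∈ H^{2q}(X(ℂ); ℂ)` dying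
on `(X ∖ Y)(ℂ)`, `c` lies in the `ℂ`-span of Gysin images `g_* β`, `g : W ⟶ X` from smooth projective
`W` of dimension `n − e`, `1 ≤ e`, `d + e = q`, `β` rational of type `(d, d)` — for every orientation
family `μ` with Poincaré duality (the real Gysin maps `complexGysin μ`).

Its conclusion is VERBATIM the Literature theorem
`Literature.AlgebraicGeometry.HodgeTheory.mem_iSup_map_complexGysin_of_restrictCompl_eq_zero_of_ne_univ`
(`HodgeTheory/SupportedHodgeClassesAlgebraic`, Voisin 2013, proof of Lemma 2.1), which is conditional
on three named facts of the tree: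

* `hA : Deligne1974_ker_restrictCompl_eq_iSup_range_complexGysin` (`HodgeTheory/GysinKernel`; Hodge III
  Cor. 8.2.8: `ker (Hᵇ(X) → Hᵇ(X ∖ Z)) = Σⱼ im (gⱼ)_*`) — OPEN; reduced in `HodgeTheory/GysinKernelSplit`
  (`Deligne1974_ker_restrictCompl_eq_iSup_range_complexGysin_holds_of`) to its single open child
  `Deligne1974_ker_pullback_eq_ker_pullback_resolution` (Hodge III Prop. 8.2.7, the weight argument);
* `hB : Voisin2025_hodgeClass_lift_complexGysin` (`HodgeTheory/GysinHodgeClassLift`; Voisin 2025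
  Cor. 2.12) — OPEN; reduced in `HodgeTheory/HodgeRiemannPolarizability`
  (`Voisin2025_hodgeClass_lift_complexGysin_holds_of`) to `exists_isReal_hodgeModel` (discharged:
  `exists_isReal_hodgeModel_holds`), de Rham's theorem in multiplicative form (discharged:
  `Literature.NumberTheory.Transcendental.exists_deRhamIsoFamily_holds`) and the single open input
  `smoothProjective_hodgeStructure_isPolarizable` (Hodge–Riemann, Voisin I Thm. 6.32 with Thm. 6.25);
* `hH : Resolution.Hironaka1964_projective` — DISCHARGED (`Resolution.Hironaka1964_projective_holds`),
  fed here.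

So the whole residue of the item is the pair of Literature named facts
`Deligne1974_ker_pullback_eq_ker_pullback_resolution`, `smoothProjective_hodgeStructure_isPolarizable`.

Contents: `deligneDescent_of_facts` — `DeligneDescent` from `hA`, `hB`.

CLOSING RECIPE (for the prover resumed when the facts are discharged): with
`A_holds : Deligne1974_ker_restrictCompl_eq_iSup_range_complexGysin` and
`B_holds : Voisin2025_hodgeClass_lift_complexGysin` — or, from the leaves,
`A_holds := Deligne1974_ker_restrictCompl_eq_iSup_range_complexGysin_holds_of P827_holds` and
`B_holds := Voisin2025_hodgeClass_lift_complexGysin_holds_of exists_isReal_hodgeModel_holds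
  (fun E _ _ _ ↦ Literature.NumberTheory.Transcendental.exists_deRhamIsoFamily_holds E) pol_holds` —
append `theorem deligneDescent_proof : DeligneDescent := deligneDescent_of_facts A_holds B_holds`
(`--workitem stmt-HodgeConjecture-2786`) and release the item `--by` it.

## References

* [DeligneHodgeIII1974] P. Deligne, Théorie de Hodge III, Publ. Math. IHÉS 44 (1974), Prop. 8.2.7,
  Cor. 8.2.8.
* [Voisin2025] C. Voisin, Hodge and generalized Hodge conjectures, coniveau and algebraic cycles,
  J. Open Math. Probl. 1 (2025), Prop. 2.11, Cor. 2.12, Thm. 4.4, Cor. 4.5.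
* [Voisin2013GHCBloch] C. Voisin, The generalized Hodge and Bloch conjectures are equivalent for
  general complete intersections, Ann. Sci. ÉNS 46 (2013), proof of Lemma 2.1.
* [VoisinHodgeI2002] C. Voisin, Hodge Theory and Complex Algebraic Geometry I, Thm. 6.25, Thm. 6.32,
  Lemma 7.26, §7.3.2.
* [Kollar2007] J. Kollár, Lectures on Resolution of Singularities, Thm. 3.27. [Hironaka1964]
* [Jannsen1990MixedMotives] U. Jannsen, Mixed Motives and Algebraic K-Theory, LNM 1400, §7.
-/

noncomputable section

-- mandated namespace `Summit.HodgeConjecture.HodgeConjecture.Theorems` (single-problem summit: Problem =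
-- Summit) trips `linter.dupNamespace`; off tree-wide in the lakefile, restated for stand-alone elaboration.
set_option linter.dupNamespace false

open Literature.AlgebraicGeometry Literature.AlgebraicGeometry.HodgeTheory
open Summit.HodgeConjecture.HodgeConjecture.Theses.CurveNetMordellWeil

namespace Summit.HodgeConjecture.HodgeConjecture.Theorems

/-- **`DeligneDescent` from the two named facts of the tree** (route `CurveNetMordellWeil`, item
stmt-HodgeConjecture-2786): Deligne's description of the kernel of restriction to a Zariski-open
complement as the sum of the Gysin images from resolutions of the components (`hA`, Hodge III
Cor. 8.2.8) and the lifting of Hodge classes along sums of Gysin morphisms by semisimplicity of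
polarisable Hodge structures (`hB`, Voisin 2025 Cor. 2.12); the resolutions come from the tree's
theorem `Resolution.Hironaka1964_projective_holds`, and the components of the proper closed `Y ≠ X`
have codimension `≥ 1`. One line over
`mem_iSup_map_complexGysin_of_restrictCompl_eq_zero_of_ne_univ`, whose conclusion is the item verbatim.
[cite: DeligneHodgeIII1974, Cor. 8.2.8] [cite: Voisin2025, Cor. 2.12 and Cor. 4.5]
[cite: Voisin2013GHCBloch, Lemma 2.1 (proof)] [cite: Kollar2007, Thm. 3.27] -/
theorem deligneDescent_of_facts
    (hA : Deligne1974_ker_restrictCompl_eq_iSup_range_complexGysin)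
    (hB : Voisin2025_hodgeClass_lift_complexGysin) :
    DeligneDescent := by
  intro μ hμ n q X hX Y hY hYne c hc hc' h0
  exact mem_iSup_map_complexGysin_of_restrictCompl_eq_zero_of_ne_univ hA hB
    Resolution.Hironaka1964_projective_holds μ hμ hX hY hYne hc hc' h0

end Summit.HodgeConjecture.HodgeConjecture.Theorems

end
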